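import Summits.BirchSwinnertonDyer.BirchSwinnertonDyer.Theorems.Rank2Observatory2DescKillConic
import Summits.BirchSwinnertonDyer.BirchSwinnertonDyer.Theorems.ShaPrimaryTransferFiniteShaComponentTransferSelmerCubicKillQKMod
import Mathlib.NumberTheory.Padics.ProperSpace
import HarnessLib

/-!
# BirchSwinnertonDyer — SEL2CUBIC kill layer: the QK (conic-point / binary-quartic) kill certificate in RESIDUE form

HONEST FRAMING: route `ShaPrimaryTransfer`, seat `bsd-line-spt-p1` (g32), `--supports` item T =
`FiniteShaComponentTransfer` (stmt-22356), UNCHANGED (conjecture-grade at corank ≥ 2). BSD in rank ≥ 2 is NOT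
proved by any of this. THEOREMS ONLY.

The census QK kill (`Rank2Observatory2DescKillConic.qkCert_sound`, 291 census rows dropped by g31's SEL2CUBIC converter)
proves that the quadric pair `killQ = (Q₁, Q₂)` of a `2`-descent class has no INTEGER zero primitive at `p`, by passing
through a rational point `P₀` of the class conic `C = c₁Q₁ + c₂Q₂`: every zero `r` of `C` is `Φ(u, v)` up to a scalar,
and `Ĝ(u, v) = −τ·D_w(Φ(u, v))/s²` is then a square, refuted by the residue tree `qkCheck`. A `2`-SELMER class only
yields a `p`-ADIC zero of `killQ` (g30, `…SelmerCubicKillLocal`), and the SEL2CUBIC doors consume kills in RESIDUE form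
(«for some `N`, no `p`-primitive integer vector `v` has `p^N ∣ Q₁(v), Q₂(v)`», `…KillSelList.admKillsV_sound_sel`).
This file closes the gap:

* **`qkCert_core`** — the algebraic half of `qkCert_sound` over an arbitrary FIELD: from the certificate identities and a
  non-zero zero of `killQ`, scalars `κ ≠ 0`, `(u, v) ≠ 0`, `M` with `κ²·s²·Ĝ(u, v) = M²` (the adjugate decomposition
  `D·r = κP₀ + uA + vB`, `Φ(u, v) = −βD·r`, and the tangent case `Φ(β_B, −β_A) = R·P₀`, verbatim from the integer proof);
* **`qkCert_sound_padic`** — with `qkCheck` over `ℚ_p` (`…KillQKMod.qk_no_square_padic`): the quadric pair has NO non-zero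
  zero in `ℚ_p⁴` (the `2`-covering of the class has no `ℚ_p`-point, literally);
* **`killResidue_of_forall_padic_ne_zero`** — COMPACTNESS OF `ℤ_p⁴`: if `killQ` has no non-zero `ℚ_p`-zero then for some
  `N` no `p`-primitive integer vector has `p^N ∣ Q₁, Q₂` (Cantor intersection of the closed sets
  `{‖w‖ = 1, ‖Qᵢ(w)‖ ≤ p^{−N}}`; the converse of g30's `exists_primitive_killQ_dvd_of_padic_zero`);
* **`killResidue_of_qkCert`** — the census certificate in the doors' hypothesis shape (as `killResidue_of_conicCert`).
[cite: Cassels1991LecturesEllipticCurves, §15] [cite: CremonaAlgorithms1997, §3.6]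
[cite: BorevichShafarevich1966, Ch. I §5.2 (solvability mod all `p^N` ⟺ `p`-adic solvability)]
-/

-- single-conjunct summit: `Summit.BirchSwinnertonDyer.BirchSwinnertonDyer.…` repeats the name by design
set_option linter.dupNamespace false

noncomputable section

namespace Summit.BirchSwinnertonDyer.BirchSwinnertonDyer.Theorems.ShaPrimaryTransferSelmerCubicKill

open Summit.BirchSwinnertonDyer.BirchSwinnertonDyer.Rank2Observatory
open Summit.BirchSwinnertonDyer.BirchSwinnertonDyer.Rank2Observatory.TwoDescKill

/-! ## §1 The conic algebra commutes with the cast `ℤ → F` -/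

section Cast

variable {F : Type*} [CommRing F]

/-- `hq` commutes with the cast. [folklore] -/
theorem hq_intCast (a b c : ℤ) (z : ℤ × ℤ × ℤ) (c₁ c₂ : ℤ) (r s : ℤ × ℤ × ℤ) :
    ((hq a b c z c₁ c₂ r s : ℤ) : F) = hq (a : F) (b : F) (c : F) ((z.1 : F), (z.2.1 : F), (z.2.2 : F)) (c₁ : F) (c₂ : F) ((r.1 : F), (r.2.1 : F), (r.2.2 : F)) ((s.1 : F), (s.2.1 : F), (s.2.2 : F)) := by
  simp only [hq, lz, mul3]; push_cast; ring

/-- `cq` commutes with the cast. [folklore] -/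
theorem cq_intCast (a b c : ℤ) (z : ℤ × ℤ × ℤ) (c₁ c₂ : ℤ) (r : ℤ × ℤ × ℤ) :
    ((cq a b c z c₁ c₂ r : ℤ) : F) = cq (a : F) (b : F) (c : F) ((z.1 : F), (z.2.1 : F), (z.2.2 : F)) (c₁ : F) (c₂ : F) ((r.1 : F), (r.2.1 : F), (r.2.2 : F)) := by
  simp only [cq, hq_intCast]

/-- `bq` commutes with the cast. [folklore] -/
theorem bq_intCast (a b c : ℤ) (z : ℤ × ℤ × ℤ) (c₁ c₂ : ℤ) (r s : ℤ × ℤ × ℤ) :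
    ((bq a b c z c₁ c₂ r s : ℤ) : F) = bq (a : F) (b : F) (c : F) ((z.1 : F), (z.2.1 : F), (z.2.2 : F)) (c₁ : F) (c₂ : F) ((r.1 : F), (r.2.1 : F), (r.2.2 : F)) ((s.1 : F), (s.2.1 : F), (s.2.2 : F)) := by
  simp only [bq]; push_cast; rw [hq_intCast]

/-- `lin3` commutes with the cast. [folklore] -/
theorem lin3_intCast (u : ℤ) (A : ℤ × ℤ × ℤ) (v : ℤ) (B : ℤ × ℤ × ℤ) :
    (((lin3 u A v B).1 : F), ((lin3 u A v B).2.1 : F), ((lin3 u A v B).2.2 : F)) = lin3 (u : F) ((A.1 : F), (A.2.1 : F), (A.2.2 : F)) (v : F) ((B.1 : F), (B.2.1 : F), (B.2.2 : F)) := by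
  simp only [lin3]; push_cast; rfl

/-- `tri3` commutes with the cast. [folklore] -/
theorem tri3_intCast (α : ℤ) (X : ℤ × ℤ × ℤ) (β : ℤ) (Y : ℤ × ℤ × ℤ) (γ : ℤ) (Z : ℤ × ℤ × ℤ) :
    (((tri3 α X β Y γ Z).1 : F), ((tri3 α X β Y γ Z).2.1 : F), ((tri3 α X β Y γ Z).2.2 : F)) = tri3 (α : F) ((X.1 : F), (X.2.1 : F), (X.2.2 : F)) (β : F) ((Y.1 : F), (Y.2.1 : F), (Y.2.2 : F)) (γ : F) ((Z.1 : F), (Z.2.1 : F), (Z.2.2 : F)) := by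
  simp only [tri3]; push_cast; rfl

/-- `phi2` commutes with the cast. [folklore] -/
theorem phi2_intCast (a b c : ℤ) (z : ℤ × ℤ × ℤ) (c₁ c₂ : ℤ) (P₀ A : ℤ × ℤ × ℤ) :
    (((phi2 a b c z c₁ c₂ P₀ A).1 : F), ((phi2 a b c z c₁ c₂ P₀ A).2.1 : F), ((phi2 a b c z c₁ c₂ P₀ A).2.2 : F)) =
      phi2 (a : F) (b : F) (c : F) ((z.1 : F), (z.2.1 : F), (z.2.2 : F)) (c₁ : F) (c₂ : F) ((P₀.1 : F), (P₀.2.1 : F), (P₀.2.2 : F)) ((A.1 : F), (A.2.1 : F), (A.2.2 : F)) := by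
  simp only [phi2, lin3_intCast]; push_cast; rw [cq_intCast, bq_intCast]

/-- `phi11` commutes with the cast. [folklore] -/
theorem phi11_intCast (a b c : ℤ) (z : ℤ × ℤ × ℤ) (c₁ c₂ : ℤ) (P₀ A B : ℤ × ℤ × ℤ) :
    (((phi11 a b c z c₁ c₂ P₀ A B).1 : F), ((phi11 a b c z c₁ c₂ P₀ A B).2.1 : F), ((phi11 a b c z c₁ c₂ P₀ A B).2.2 : F)) =
      phi11 (a : F) (b : F) (c : F) ((z.1 : F), (z.2.1 : F), (z.2.2 : F)) (c₁ : F) (c₂ : F) ((P₀.1 : F), (P₀.2.1 : F), (P₀.2.2 : F)) ((A.1 : F), (A.2.1 : F), (A.2.2 : F)) ((B.1 : F), (B.2.1 : F), (B.2.2 : F)) := by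
  simp only [phi11, tri3_intCast]; push_cast; rw [bq_intCast, bq_intCast, bq_intCast]

/-- `gcoef` commutes with the cast (componentwise). [folklore] -/
theorem gcoef_intCast (a b c : ℤ) (z : ℤ × ℤ × ℤ) (c₁ c₂ w₁ w₂ τ : ℤ) (P₀ A B : ℤ × ℤ × ℤ) :
    let G := gcoef a b c z c₁ c₂ w₁ w₂ τ P₀ A B
    (((G.1 : ℤ) : F), ((G.2.1 : ℤ) : F), ((G.2.2.1 : ℤ) : F), ((G.2.2.2.1 : ℤ) : F), ((G.2.2.2.2 : ℤ) : F)) =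
      gcoef (a : F) (b : F) (c : F) ((z.1 : F), (z.2.1 : F), (z.2.2 : F)) (c₁ : F) (c₂ : F) (w₁ : F) (w₂ : F) (τ : F) ((P₀.1 : F), (P₀.2.1 : F), (P₀.2.2 : F)) ((A.1 : F), (A.2.1 : F), (A.2.2 : F)) ((B.1 : F), (B.2.1 : F), (B.2.2 : F)) := by
  simp only [gcoef, ← phi2_intCast, ← phi11_intCast, ← hq_intCast]
  push_cast
  rfl

end Cast

/-! ## §2 The algebraic half over a field -/

/-- **The algebraic half of the QK kill over a field.** Given the certificate identities — `c·t = 0`, `τ = w·t ≠ 0`,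
`C(P₀) = 0`, the adjugate identities `adj · [P₀ A B] = D·1`, `D ≠ 0`, `R = C(β_B A − β_A B) ≠ 0`,
`gcoef = s²·ĝ` — every non-zero zero `(r, n)` of `killQ` yields `κ ≠ 0`, `(u, v) ≠ 0` and `M` with
`κ²·(s²·Ĝ(u, v)) = M²`. [cite: Cassels1991LecturesEllipticCurves, §15] -/
theorem qkCert_core {F : Type*} [Field F] (a b c : F) (z : F × F × F) (t₁ t₂ c₁ c₂ w₁ w₂ : F)
    (P₀ A B lP lA lB : F × F × F) (D s : F) (g : F × F × F × F × F)
    (hct : c₁ * t₁ + c₂ * t₂ = 0) (hτ : w₁ * t₁ + w₂ * t₂ ≠ 0) (hP : cq a b c z c₁ c₂ P₀ = 0)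
    (e11 : lP.1 * P₀.1 + lA.1 * A.1 + lB.1 * B.1 = D) (e21 : lP.2.1 * P₀.1 + lA.2.1 * A.1 + lB.2.1 * B.1 = 0)
    (e31 : lP.2.2 * P₀.1 + lA.2.2 * A.1 + lB.2.2 * B.1 = 0) (e12 : lP.1 * P₀.2.1 + lA.1 * A.2.1 + lB.1 * B.2.1 = 0)
    (e22 : lP.2.1 * P₀.2.1 + lA.2.1 * A.2.1 + lB.2.1 * B.2.1 = D)
    (e32 : lP.2.2 * P₀.2.1 + lA.2.2 * A.2.1 + lB.2.2 * B.2.1 = 0)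
    (e13 : lP.1 * P₀.2.2 + lA.1 * A.2.2 + lB.1 * B.2.2 = 0) (e23 : lP.2.1 * P₀.2.2 + lA.2.1 * A.2.2 + lB.2.1 * B.2.2 = 0)
    (e33 : lP.2.2 * P₀.2.2 + lA.2.2 * A.2.2 + lB.2.2 * B.2.2 = D) (hD : D ≠ 0)
    (hR : cq a b c z c₁ c₂ (lin3 (bq a b c z c₁ c₂ P₀ B) A (-(bq a b c z c₁ c₂ P₀ A)) B) ≠ 0)
    (hg : gcoef a b c z c₁ c₂ w₁ w₂ (w₁ * t₁ + w₂ * t₂) P₀ A B =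
      (s ^ 2 * g.1, s ^ 2 * g.2.1, s ^ 2 * g.2.2.1, s ^ 2 * g.2.2.2.1, s ^ 2 * g.2.2.2.2))
    (r₀ r₁ r₂ n : F) (hv : ¬ (r₀ = 0 ∧ r₁ = 0 ∧ r₂ = 0 ∧ n = 0)) (h0 : killQ a b c z t₁ t₂ (r₀, r₁, r₂, n) = 0) :
    ∃ κ u v M : F, κ ≠ 0 ∧ ¬ (u = 0 ∧ v = 0) ∧ κ ^ 2 * (s ^ 2 * quartEval g u v) = M * M := by
  -- name the certificate quantities
  obtain ⟨τ, hτd⟩ : ∃ x, w₁ * t₁ + w₂ * t₂ = x := ⟨_, rfl⟩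
  obtain ⟨bA, hbA⟩ : ∃ x, bq a b c z c₁ c₂ P₀ A = x := ⟨_, rfl⟩
  obtain ⟨bB, hbB⟩ : ∃ x, bq a b c z c₁ c₂ P₀ B = x := ⟨_, rfl⟩
  obtain ⟨cA, hcA⟩ : ∃ x, cq a b c z c₁ c₂ A = x := ⟨_, rfl⟩
  obtain ⟨cB, hcB⟩ : ∃ x, cq a b c z c₁ c₂ B = x := ⟨_, rfl⟩
  obtain ⟨cAB, hcAB⟩ : ∃ x, bq a b c z c₁ c₂ A B = x := ⟨_, rfl⟩
  rw [hbA, hbB] at hR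
  obtain ⟨R, hRd⟩ : ∃ x, cq a b c z c₁ c₂ (lin3 bB A (-bA) B) = x := ⟨_, rfl⟩
  rw [hRd] at hR
  rw [hτd] at hτ hg
  -- the two quadrics through the conic and through `D_w`
  have hcr : cq a b c z c₁ c₂ (r₀, r₁, r₂) = 0 := by
    rw [cq_killQ a b c z c₁ c₂ t₁ t₂ r₀ r₁ r₂ n h0, hct]; ring
  have hdr : cq a b c z w₁ w₂ (r₀, r₁, r₂) = -τ * n ^ 2 := by
    rw [cq_killQ a b c z w₁ w₂ t₁ t₂ r₀ r₁ r₂ n h0, hτd]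
  -- `r ≠ 0`
  have hr0 : ¬ (r₀ = 0 ∧ r₁ = 0 ∧ r₂ = 0) := by
    rintro ⟨e0, e1, e2⟩
    subst e0 e1 e2
    have hn : n ≠ 0 := fun hn => hv ⟨rfl, rfl, rfl, hn⟩
    have hn2 : n ^ 2 ≠ 0 := pow_ne_zero _ hn
    have hz : cq a b c z w₁ w₂ ((0 : F), (0 : F), (0 : F)) = 0 := by
      simp [cq, hq, lz, mul3]
    rw [hz] at hdr
    exact hτ ((mul_eq_zero.mp (by linear_combination hdr : τ * n ^ 2 = 0)).resolve_right hn2)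
  -- the adjugate decomposition `D·r = κ·P₀ + u₁·A + v₁·B`
  obtain ⟨κ, hκ⟩ : ∃ x, lP.1 * r₀ + lP.2.1 * r₁ + lP.2.2 * r₂ = x := ⟨_, rfl⟩
  obtain ⟨u₁, hu₁⟩ : ∃ x, lA.1 * r₀ + lA.2.1 * r₁ + lA.2.2 * r₂ = x := ⟨_, rfl⟩
  obtain ⟨v₁, hv₁⟩ : ∃ x, lB.1 * r₀ + lB.2.1 * r₁ + lB.2.2 * r₂ = x := ⟨_, rfl⟩
  have d1 : D * r₀ = κ * P₀.1 + (u₁ * A.1 + v₁ * B.1) := by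
    rw [← hκ, ← hu₁, ← hv₁]; linear_combination -(r₀ * e11 + r₁ * e21 + r₂ * e31)
  have d2 : D * r₁ = κ * P₀.2.1 + (u₁ * A.2.1 + v₁ * B.2.1) := by
    rw [← hκ, ← hu₁, ← hv₁]; linear_combination -(r₀ * e12 + r₁ * e22 + r₂ * e32)
  have d3 : D * r₂ = κ * P₀.2.2 + (u₁ * A.2.2 + v₁ * B.2.2) := by
    rw [← hκ, ← hu₁, ← hv₁]; linear_combination -(r₀ * e13 + r₁ * e23 + r₂ * e33)
  obtain ⟨β, hβ⟩ : ∃ x, bq a b c z c₁ c₂ P₀ (lin3 u₁ A v₁ B) = x := ⟨_, rfl⟩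
  obtain ⟨γ, hγ⟩ : ∃ x, cq a b c z c₁ c₂ (lin3 u₁ A v₁ B) = x := ⟨_, rfl⟩
  have eβ : β = u₁ * bA + v₁ * bB := by rw [← hβ, bq_lin3, hbA, hbB]
  have eγ : γ = u₁ ^ 2 * cA + u₁ * v₁ * cAB + v₁ ^ 2 * cB := by rw [← hγ, cq_lin3, hcA, hcB, hcAB]
  have eR : R = bB ^ 2 * cA + bB * (-bA) * cAB + (-bA) ^ 2 * cB := by
    rw [← hRd, cq_lin3, hcA, hcB, hcAB]
  have hDr : ((D * r₀, D * r₁, D * r₂) : F × F × F) = lin3 κ P₀ 1 (lin3 u₁ A v₁ B) := by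
    rw [d1, d2, d3]
    simp only [lin3, Prod.mk.injEq]
    exact ⟨by ring, by ring, by ring⟩
  -- `cq(X) = −κβ`
  have hγκ : γ + κ * β = 0 := by
    have h1 := cq_smul3 a b c z c₁ c₂ D r₀ r₁ r₂
    rw [hDr, cq_lin3, hP, hβ, hγ, hcr] at h1
    linear_combination h1
  -- `Φ(u₁, v₁) = −βD·r`
  have hphi : phi a b c z c₁ c₂ P₀ A B u₁ v₁ = (-(β * D) * r₀, -(β * D) * r₁, -(β * D) * r₂) := by
    unfold phi
    rw [hβ, hγ]
    simp only [lin3, Prod.mk.injEq]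
    exact ⟨by linear_combination P₀.1 * hγκ + β * d1,
      by linear_combination P₀.2.1 * hγκ + β * d2,
      by linear_combination P₀.2.2 * hγκ + β * d3⟩
  -- `s²·Ĝ(u₁, v₁) = (τβDn)²`
  have hG1 : s ^ 2 * quartEval g u₁ v₁ = (τ * β * D * n) ^ 2 := by
    have e1 := quartEval_gcoef a b c z c₁ c₂ w₁ w₂ τ P₀ A B u₁ v₁
    rw [hg, quartEval_coeff_smul, hphi, cq_smul3, hdr] at e1
    linear_combination e1
  by_cases hβ0 : β = 0
  · -- tangent case: `X = 0`, `D·r = κ·P₀`, use `Φ(β_B, −β_A) = R·P₀`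
    have hγ0 : γ = 0 := by linear_combination hγκ - κ * hβ0
    have hX1 : u₁ * bA + v₁ * bB = 0 := by rw [← eβ, hβ0]
    have hX2 : u₁ ^ 2 * cA + u₁ * v₁ * cAB + v₁ ^ 2 * cB = 0 := by rw [← eγ, hγ0]
    have hu0 : u₁ = 0 := by
      have h : u₁ ^ 2 * R = 0 := by
        rw [eR]
        linear_combination bB ^ 2 * hX2 + (-(u₁ * bB * cAB) + cB * (u₁ * bA - v₁ * bB)) * hX1
      exact (pow_eq_zero_iff two_ne_zero).mp ((mul_eq_zero.mp h).resolve_right hR)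
    have hv0 : v₁ = 0 := by
      have h : v₁ ^ 2 * R = 0 := by
        rw [eR]
        linear_combination bA ^ 2 * hX2 + (cA * (v₁ * bB - u₁ * bA) - v₁ * bA * cAB) * hX1
      exact (pow_eq_zero_iff two_ne_zero).mp ((mul_eq_zero.mp h).resolve_right hR)
    subst hu0 hv0
    have k1 : D * r₀ = κ * P₀.1 := by rw [d1]; ring
    have k2 : D * r₁ = κ * P₀.2.1 := by rw [d2]; ring
    have k3 : D * r₂ = κ * P₀.2.2 := by rw [d3]; ring
    have hκ0 : κ ≠ 0 := by
      intro hκ0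
      rw [hκ0, zero_mul] at k1 k2 k3
      exact hr0 ⟨(mul_eq_zero.mp k1).resolve_left hD, (mul_eq_zero.mp k2).resolve_left hD,
        (mul_eq_zero.mp k3).resolve_left hD⟩
    have huv : ¬ (bB = 0 ∧ -bA = 0) := by
      rintro ⟨h1, h2⟩
      apply hR
      rw [eR, h1, neg_eq_zero.mp h2]; ring
    have hphiT : phi a b c z c₁ c₂ P₀ A B bB (-bA) = (R * P₀.1, R * P₀.2.1, R * P₀.2.2) := by
      unfold phi
      rw [bq_lin3, hbA, hbB, hRd]
      simp only [lin3, Prod.mk.injEq]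
      exact ⟨by ring, by ring, by ring⟩
    have e2 : κ ^ 2 * cq a b c z w₁ w₂ P₀ = D ^ 2 * (-τ * n ^ 2) := by
      have h1 := cq_smul3 a b c z w₁ w₂ D r₀ r₁ r₂
      have h2 := cq_smul3 a b c z w₁ w₂ κ P₀.1 P₀.2.1 P₀.2.2
      rw [k1, k2, k3, h2, hdr] at h1
      simpa only [Prod.mk.eta] using h1
    have hG2 : κ ^ 2 * (s ^ 2 * quartEval g bB (-bA)) = (τ * R * D * n) * (τ * R * D * n) := by
      have e1 := quartEval_gcoef a b c z c₁ c₂ w₁ w₂ τ P₀ A B bB (-bA)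
      rw [hg, quartEval_coeff_smul, hphiT, cq_smul3] at e1
      simp only [Prod.mk.eta] at e1
      linear_combination κ ^ 2 * e1 - τ * R ^ 2 * e2
    exact ⟨κ, bB, -bA, τ * R * D * n, hκ0, huv, hG2⟩
  · -- generic case: `(u₁, v₁) ≠ 0` and `s²·Ĝ(u₁, v₁)` is a square
    have huv : ¬ (u₁ = 0 ∧ v₁ = 0) := by
      rintro ⟨h1, h2⟩; apply hβ0; rw [eβ, h1, h2]; ring
    exact ⟨1, u₁, v₁, τ * β * D * n, one_ne_zero, huv, by linear_combination hG1⟩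

/-! ## §3 Over `ℚ_p`: the quadric pair of a certified class has no `p`-adic zero -/

section Padic

variable {p : ℕ} [Fact p.Prime]

/-- **Soundness of the QK kill over `ℚ_p`**: if the certificate checks and the residue tree of the reduced quartic is
certified at `p`, then `killQ` has NO non-zero zero in `ℚ_p⁴` — the `2`-covering of the class has no `ℚ_p`-point.
[cite: Cassels1991LecturesEllipticCurves, §15] [cite: CremonaAlgorithms1997, §3.6] -/
theorem qkCert_sound_padic {a b c : ℤ} {z : ℤ × ℤ × ℤ} {t₁ t₂ : ℤ} {Γ : QKCert}
    (hc : qkCertCheck a b c z t₁ t₂ Γ = true) (hk : qkCheck p Γ.g Γ.fuel = true)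
    (u : ℚ_[p] × ℚ_[p] × ℚ_[p] × ℚ_[p]) (hu : u ≠ 0)
    (h0 : killQ (a : ℚ_[p]) (b : ℚ_[p]) (c : ℚ_[p]) ((z.1 : ℚ_[p]), (z.2.1 : ℚ_[p]), (z.2.2 : ℚ_[p]))
      (t₁ : ℚ_[p]) (t₂ : ℚ_[p]) u = 0) : False := by
  obtain ⟨r₀, r₁, r₂, n⟩ := u
  simp only [qkCertCheck, adjCheck, Bool.and_eq_true, decide_eq_true_eq] at hc
  obtain ⟨⟨⟨⟨⟨⟨⟨hct, hτ⟩, hP⟩, ⟨⟨⟨⟨⟨⟨⟨⟨e11, e21⟩, e31⟩, e12⟩, e22⟩, e32⟩, e13⟩, e23⟩, e33⟩⟩,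
    hD⟩, hR⟩, hs⟩, hg⟩ := hc
  have hv : ¬ (r₀ = 0 ∧ r₁ = 0 ∧ r₂ = 0 ∧ n = 0) := by
    rintro ⟨e0, e1, e2, e3⟩; exact hu (by rw [e0, e1, e2, e3]; rfl)
  -- cast the certificate identities into `ℚ_p`
  have hP' : cq (a : ℚ_[p]) (b : ℚ_[p]) (c : ℚ_[p]) ((z.1 : ℚ_[p]), (z.2.1 : ℚ_[p]), (z.2.2 : ℚ_[p])) (Γ.c₁ : ℚ_[p]) (Γ.c₂ : ℚ_[p]) ((Γ.P₀.1 : ℚ_[p]), (Γ.P₀.2.1 : ℚ_[p]), (Γ.P₀.2.2 : ℚ_[p])) = 0 := by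
    rw [← cq_intCast, hP, Int.cast_zero]
  have hR' : cq (a : ℚ_[p]) (b : ℚ_[p]) (c : ℚ_[p]) ((z.1 : ℚ_[p]), (z.2.1 : ℚ_[p]), (z.2.2 : ℚ_[p])) (Γ.c₁ : ℚ_[p]) (Γ.c₂ : ℚ_[p])
      (lin3 (bq (a : ℚ_[p]) (b : ℚ_[p]) (c : ℚ_[p]) ((z.1 : ℚ_[p]), (z.2.1 : ℚ_[p]), (z.2.2 : ℚ_[p])) (Γ.c₁ : ℚ_[p]) (Γ.c₂ : ℚ_[p]) ((Γ.P₀.1 : ℚ_[p]), (Γ.P₀.2.1 : ℚ_[p]), (Γ.P₀.2.2 : ℚ_[p])) ((Γ.B.1 : ℚ_[p]), (Γ.B.2.1 : ℚ_[p]), (Γ.B.2.2 : ℚ_[p])))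
        ((Γ.A.1 : ℚ_[p]), (Γ.A.2.1 : ℚ_[p]), (Γ.A.2.2 : ℚ_[p])) (-(bq (a : ℚ_[p]) (b : ℚ_[p]) (c : ℚ_[p]) ((z.1 : ℚ_[p]), (z.2.1 : ℚ_[p]), (z.2.2 : ℚ_[p])) (Γ.c₁ : ℚ_[p]) (Γ.c₂ : ℚ_[p]) ((Γ.P₀.1 : ℚ_[p]), (Γ.P₀.2.1 : ℚ_[p]), (Γ.P₀.2.2 : ℚ_[p]))
          ((Γ.A.1 : ℚ_[p]), (Γ.A.2.1 : ℚ_[p]), (Γ.A.2.2 : ℚ_[p])))) ((Γ.B.1 : ℚ_[p]), (Γ.B.2.1 : ℚ_[p]), (Γ.B.2.2 : ℚ_[p]))) ≠ 0 := by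
    rw [← bq_intCast, ← bq_intCast, ← Int.cast_neg, ← lin3_intCast, ← cq_intCast]
    exact_mod_cast hR
  have hg' := gcoef_intCast (F := ℚ_[p]) a b c z Γ.c₁ Γ.c₂ Γ.w₁ Γ.w₂ (Γ.w₁ * t₁ + Γ.w₂ * t₂) Γ.P₀ Γ.A Γ.B
  simp only [hg] at hg'
  push_cast at hg'
  obtain ⟨κ, u₁, v₁, M, hκ, huv, hM⟩ := qkCert_core (F := ℚ_[p]) (a : ℚ_[p]) (b : ℚ_[p]) (c : ℚ_[p]) ((z.1 : ℚ_[p]), (z.2.1 : ℚ_[p]), (z.2.2 : ℚ_[p]))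
    (t₁ : ℚ_[p]) (t₂ : ℚ_[p]) (Γ.c₁ : ℚ_[p]) (Γ.c₂ : ℚ_[p]) (Γ.w₁ : ℚ_[p]) (Γ.w₂ : ℚ_[p])
    ((Γ.P₀.1 : ℚ_[p]), (Γ.P₀.2.1 : ℚ_[p]), (Γ.P₀.2.2 : ℚ_[p])) ((Γ.A.1 : ℚ_[p]), (Γ.A.2.1 : ℚ_[p]), (Γ.A.2.2 : ℚ_[p])) ((Γ.B.1 : ℚ_[p]), (Γ.B.2.1 : ℚ_[p]), (Γ.B.2.2 : ℚ_[p])) ((Γ.lP.1 : ℚ_[p]), (Γ.lP.2.1 : ℚ_[p]), (Γ.lP.2.2 : ℚ_[p])) ((Γ.lA.1 : ℚ_[p]), (Γ.lA.2.1 : ℚ_[p]), (Γ.lA.2.2 : ℚ_[p])) ((Γ.lB.1 : ℚ_[p]), (Γ.lB.2.1 : ℚ_[p]), (Γ.lB.2.2 : ℚ_[p])) (Γ.D : ℚ_[p]) (Γ.s : ℚ_[p])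
    ((Γ.g.1 : ℚ_[p]), (Γ.g.2.1 : ℚ_[p]), (Γ.g.2.2.1 : ℚ_[p]), (Γ.g.2.2.2.1 : ℚ_[p]), (Γ.g.2.2.2.2 : ℚ_[p]))
    (by exact_mod_cast hct) (by exact_mod_cast hτ) hP'
    (by dsimp only; exact_mod_cast e11) (by dsimp only; exact_mod_cast e21)
    (by dsimp only; exact_mod_cast e31) (by dsimp only; exact_mod_cast e12)
    (by dsimp only; exact_mod_cast e22) (by dsimp only; exact_mod_cast e32)
    (by dsimp only; exact_mod_cast e13) (by dsimp only; exact_mod_cast e23)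
    (by dsimp only; exact_mod_cast e33) (by exact_mod_cast hD) hR'
    (by rw [← hg']) r₀ r₁ r₂ n hv h0
  exact qk_no_square_padic hk (by exact_mod_cast hs) hκ huv hM

/-- Both components of the quadric pair on `ℤ_p⁴` are continuous (polynomials in the coordinates). [folklore] -/
theorem continuous_killQ_padicInt (a b c : ℤ) (z : ℤ × ℤ × ℤ) (t₁ t₂ : ℤ) :
    Continuous (fun w : Fin 4 → ℤ_[p] => (killQ (a : ℤ_[p]) (b : ℤ_[p]) (c : ℤ_[p])
      ((z.1 : ℤ_[p]), (z.2.1 : ℤ_[p]), (z.2.2 : ℤ_[p])) (t₁ : ℤ_[p]) (t₂ : ℤ_[p]) (w 0, w 1, w 2, w 3)).1) ∧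
      Continuous (fun w : Fin 4 → ℤ_[p] => (killQ (a : ℤ_[p]) (b : ℤ_[p]) (c : ℤ_[p])
      ((z.1 : ℤ_[p]), (z.2.1 : ℤ_[p]), (z.2.2 : ℤ_[p])) (t₁ : ℤ_[p]) (t₂ : ℤ_[p]) (w 0, w 1, w 2, w 3)).2) := by
  constructor <;> · simp only [killQ, zsq, mul3]; fun_prop

/-- **From no `p`-adic zero to the residue statement (compactness of `ℤ_p⁴`).** If the quadric pair `killQ` of a
class has no non-zero zero in `ℚ_p⁴`, then for some `N` no integer vector primitive at `p` has `p^N ∣ Q₁` and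
`p^N ∣ Q₂` — the hypothesis shape of the SEL2CUBIC doors (Cantor intersection of the closed sets `{‖w‖ = 1, ‖Qᵢ(w)‖ ≤ p^{−N}}`
in the compact `ℤ_p⁴`). [cite: BorevichShafarevich1966, Ch. I §5.2] -/
theorem killResidue_of_forall_padic_ne_zero (a b c : ℤ) (z : ℤ × ℤ × ℤ) (t₁ t₂ : ℤ)
    (h : ∀ u : ℚ_[p] × ℚ_[p] × ℚ_[p] × ℚ_[p], u ≠ 0 →
      killQ (a : ℚ_[p]) (b : ℚ_[p]) (c : ℚ_[p]) ((z.1 : ℚ_[p]), (z.2.1 : ℚ_[p]), (z.2.2 : ℚ_[p]))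
        (t₁ : ℚ_[p]) (t₂ : ℚ_[p]) u ≠ 0) :
    ∃ N : ℕ, ∀ v : ℤ × ℤ × ℤ × ℤ, ¬ ((p : ℤ) ∣ v.1 ∧ (p : ℤ) ∣ v.2.1 ∧ (p : ℤ) ∣ v.2.2.1 ∧ (p : ℤ) ∣ v.2.2.2) →
      (p : ℤ) ^ N ∣ (killQ a b c z t₁ t₂ v).1 → (p : ℤ) ^ N ∣ (killQ a b c z t₁ t₂ v).2 → False := by
  have hp : p.Prime := Fact.out
  by_contra hne
  have hex : ∀ N : ℕ, ∃ v : ℤ × ℤ × ℤ × ℤ, ¬ ((p : ℤ) ∣ v.1 ∧ (p : ℤ) ∣ v.2.1 ∧ (p : ℤ) ∣ v.2.2.1 ∧ (p : ℤ) ∣ v.2.2.2) ∧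
      (p : ℤ) ^ N ∣ (killQ a b c z t₁ t₂ v).1 ∧ (p : ℤ) ^ N ∣ (killQ a b c z t₁ t₂ v).2 := by
    intro N
    by_contra hN
    exact hne ⟨N, fun v hv h1 h2 => hN ⟨v, hv, h1, h2⟩⟩
  -- the quadric pair on `ℤ_p⁴` and the nested closed sets
  let Q : (Fin 4 → ℤ_[p]) → ℤ_[p] × ℤ_[p] := fun w => killQ (a : ℤ_[p]) (b : ℤ_[p]) (c : ℤ_[p])
    ((z.1 : ℤ_[p]), (z.2.1 : ℤ_[p]), (z.2.2 : ℤ_[p])) (t₁ : ℤ_[p]) (t₂ : ℤ_[p]) (w 0, w 1, w 2, w 3)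
  let S : ℕ → Set (Fin 4 → ℤ_[p]) := fun N =>
    {w | ‖w‖ = 1 ∧ ‖(Q w).1‖ ≤ (p : ℝ) ^ (-(N : ℤ)) ∧ ‖(Q w).2‖ ≤ (p : ℝ) ^ (-(N : ℤ))}
  obtain ⟨hc1, hc2⟩ := continuous_killQ_padicInt (p := p) a b c z t₁ t₂
  have hclosed : ∀ N, IsClosed (S N) := fun N =>
    (isClosed_eq continuous_norm continuous_const).inter
      ((isClosed_le (continuous_norm.comp hc1) continuous_const).inter
        (isClosed_le (continuous_norm.comp hc2) continuous_const))
  have hmono : ∀ N, S (N + 1) ⊆ S N := by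
    intro N w hw
    have hp1 : (1 : ℝ) ≤ p := by exact_mod_cast hp.one_lt.le
    have hle : (p : ℝ) ^ (-((N + 1 : ℕ) : ℤ)) ≤ (p : ℝ) ^ (-(N : ℤ)) :=
      zpow_le_zpow_right₀ hp1 (by push_cast; omega)
    exact ⟨hw.1, hw.2.1.trans hle, hw.2.2.trans hle⟩
  have hnonempty : ∀ N, (S N).Nonempty := by
    intro N
    obtain ⟨v, hprim, h1, h2⟩ := hex N
    let w : Fin 4 → ℤ_[p] := ![(v.1 : ℤ_[p]), (v.2.1 : ℤ_[p]), (v.2.2.1 : ℤ_[p]), (v.2.2.2 : ℤ_[p])]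
    have hQ : Q w =
        (((killQ a b c z t₁ t₂ v).1 : ℤ_[p]), ((killQ a b c z t₁ t₂ v).2 : ℤ_[p])) := by
      have hm := map_killQ (Int.castRingHom ℤ_[p]) a b c z t₁ t₂ v
      simp only [eq_intCast] at hm
      rw [hm]; rfl
    refine ⟨w, ?_, ?_, ?_⟩
    · -- primitivity: `‖w‖ = 1`
      apply le_antisymm
      · exact (pi_norm_le_iff_of_nonneg zero_le_one).mpr fun j => (w j).2
      · have hex : ∃ j, ‖w j‖ = 1 := by
          by_contra hall
          push Not at hall
          have hlt : ∀ j, ‖w j‖ < 1 := fun j => lt_of_le_of_ne (w j).2 (hall j)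
          apply hprim
          exact ⟨by simpa [w] using hlt 0, by simpa [w] using hlt 1, by simpa [w] using hlt 2, by simpa [w] using hlt 3⟩
        obtain ⟨j, hj⟩ := hex
        rw [← hj]; exact norm_le_pi_norm w j
    · rw [hQ]; exact PadicInt.norm_int_le_pow_iff_dvd.mpr h1
    · rw [hQ]; exact PadicInt.norm_int_le_pow_iff_dvd.mpr h2
  obtain ⟨w, hw⟩ := IsCompact.nonempty_iInter_of_sequence_nonempty_isCompact_isClosed S hmono hnonempty
    (hclosed 0).isCompact hclosed
  simp only [Set.mem_iInter] at hw
  -- the common point is a primitive `p`-adic zero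
  have hzero : ∀ x : ℤ_[p], (∀ N : ℕ, ‖x‖ ≤ (p : ℝ) ^ (-(N : ℤ))) → x = 0 := by
    intro x hx
    by_contra hx0
    have hpos : 0 < ‖x‖ := norm_pos_iff.mpr hx0
    have hp1 : (1 : ℝ) < p := by exact_mod_cast hp.one_lt
    obtain ⟨N, hN⟩ := exists_pow_lt_of_lt_one hpos (inv_lt_one_of_one_lt₀ hp1)
    have := hx N
    rw [zpow_neg, zpow_natCast, ← inv_pow] at this
    linarith
  have hQ1 : (Q w).1 = 0 := hzero _ fun N => (hw N).2.1
  have hQ2 : (Q w).2 = 0 := hzero _ fun N => (hw N).2.2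
  have hw1 : ‖w‖ = 1 := (hw 0).1
  refine h (((w 0 : ℤ_[p]) : ℚ_[p]), ((w 1 : ℤ_[p]) : ℚ_[p]), ((w 2 : ℤ_[p]) : ℚ_[p]), ((w 3 : ℤ_[p]) : ℚ_[p]))
    ?_ ?_
  · intro h0
    simp only [Prod.mk_eq_zero, PadicInt.coe_eq_zero] at h0
    obtain ⟨e0, e1, e2, e3⟩ := h0
    have : w = 0 := by
      funext j; fin_cases j
      · exact e0
      · exact e1
      · exact e2
      · exact e3
    rw [this, norm_zero] at hw1
    exact zero_ne_one hw1
  · have hm := map_killQ (PadicInt.Coe.ringHom (p := p)) (a : ℤ_[p]) (b : ℤ_[p]) (c : ℤ_[p])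
      ((z.1 : ℤ_[p]), (z.2.1 : ℤ_[p]), (z.2.2 : ℤ_[p])) (t₁ : ℤ_[p]) (t₂ : ℤ_[p]) (w 0, w 1, w 2, w 3)
    have hC : ∀ x : ℤ_[p], PadicInt.Coe.ringHom x = (x : ℚ_[p]) := fun x => rfl
    simp only [hC, PadicInt.coe_intCast] at hm
    rw [← hm]
    have e1 : (killQ (a : ℤ_[p]) (b : ℤ_[p]) (c : ℤ_[p]) ((z.1 : ℤ_[p]), (z.2.1 : ℤ_[p]), (z.2.2 : ℤ_[p]))
        (t₁ : ℤ_[p]) (t₂ : ℤ_[p]) (w 0, w 1, w 2, w 3)) = 0 := Prod.ext hQ1 hQ2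
    rw [e1]
    simp

/-- **The census QK kill in RESIDUE form** — the hypothesis shape of `admKillsV_sound_sel` / `killResidueQ2_cons` /
`killResidueE2Q_cons_z` / `killResidueD_cons_z`: if the certificate checks (`qkCertCheck`) and the residue tree of the
reduced quartic is certified at the prime `p` (`qkCheck`), then for some `N` no integer vector primitive at `p` has
`p^N ∣ Q₁` and `p^N ∣ Q₂`. [cite: Cassels1991LecturesEllipticCurves, §15] [cite: CremonaAlgorithms1997, §3.6] -/
theorem killResidue_of_qkCert {p : ℕ} (hp : p.Prime) {a b c : ℤ} {z : ℤ × ℤ × ℤ} {t₁ t₂ : ℤ} {Γ : QKCert}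
    (hc : qkCertCheck a b c z t₁ t₂ Γ = true) (hk : qkCheck p Γ.g Γ.fuel = true) :
    ∃ N : ℕ, ∀ v : ℤ × ℤ × ℤ × ℤ, ¬ ((p : ℤ) ∣ v.1 ∧ (p : ℤ) ∣ v.2.1 ∧ (p : ℤ) ∣ v.2.2.1 ∧ (p : ℤ) ∣ v.2.2.2) →
      (p : ℤ) ^ N ∣ (killQ a b c z t₁ t₂ v).1 → (p : ℤ) ^ N ∣ (killQ a b c z t₁ t₂ v).2 → False := by
  haveI := Fact.mk hp
  exact killResidue_of_forall_padic_ne_zero a b c z t₁ t₂ fun u hu h0 => qkCert_sound_padic hc hk u hu h0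

end Padic

end Summit.BirchSwinnertonDyer.BirchSwinnertonDyer.Theorems.ShaPrimaryTransferSelmerCubicKill

end
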